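import Literature.AnabelianGeometry.SemiGraphs.EdgeSectionMono

/-!
# The EDGE section map at an ISOLATED edge is a monomorphism — no alignment needed
# ([SemiAnbd] §1 p. 12, Def. 2.2 (i) p. 23, Rem. 2.2.1 p. 24)

Mochizuki, *Semi-graphs of anabelioids*, Publ. RIMS **42** (2006) 221–322, §1 p. 12 (isolated edges:
verticial cardinality `0`), §2 Def. 2.2 (i) p. 23, Rem. 2.2.1 p. 24 [cite: MochizukiSemiAnbd2006, Rem. 2.2.1 p.24].

PROOF-ONLY companion (abc-iut cell, layer L3; FACT-LIST row F-1478 `remark_2_4_1_covering`, residual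
(L)/(J1), sub-brick (L-σ) at EDGES; seat abc-iut-w4-d079, answering abc-iut-w5-d041's crew question
«`σ_{e′}` mono at an ISOLATED edge `e′`»).  For a covering `ψ : ℋ → 𝒦` with a global witness
(`αψ : B(𝒦)_{/A} ⥲ B(ℋ)`, `e_ψ`) and a local edge witness at `e′ ↦ f` on a CONNECTED `Q ↪ A_f`
(`α_{e′}`, `e_{e′}`), the edge section map `σ_{e′} : Q ⟶ A_f` of `K_{e′} = αψ ⋙ ρ_{e′} ⋙ α_{e′}⁻¹`
(`EdgeSectionBasePoint`, written out via `OverStar.sectionMap`) is a monomorphism WHENEVER `e′` IS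
ISOLATED in `ℋ` (no branch of `e′` abuts to a vertex) — with NO vertex or branch alignment (both are
vacuous at `e′`).  The companion `Hom.IsBranchAligned.sectionMapE_mono` (`EdgeSectionMono`) treats the
edges having an abutting branch; together they cover every edge.

* `comap_range_eq_range_of_surjective` — group theory of the square `Π_{e′} → Π_f → Π_{𝒦,f}`,
  `Π_{e′} ↠ Π_{ℋ,e′} → Π_{𝒦,f}` (`Π_{𝒦,f} := Aut (ρ_f ⋙ F)`, `Π_{ℋ,e′} := Aut (ρ_{e′} ⋙ F_{e′})`): if the
  left leg is SURJECTIVE and `ker(Π_f → Π_{𝒦,f}) ≤ ι_{e′}(Π_{e′})`, the preimage of `ι(Π_{ℋ,e′})` in `Π_f`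
  is `ι_{e′}(Π_{e′})`;
* `pi1Map_surjective_of_section` — abstract: along a functor `G : D ⥤ D′` admitting objectwise
  sections (`j T` with `G (j T) ≅ T`, lifts of morphisms, and maps `X ⟶ j (G X)` over `G X`),
  whiskering `Aut F → Aut (G ⋙ F)` is surjective for EVERY `F : D′ ⥤ FintypeCat`;
* `SemiGraph.IsIsolatedEdge.abuts_eq_none`, `edgeOf_ne_of_isolated` — bookkeeping of [SemiAnbd] §1
  p. 12 (an isolated edge has no abutting branch);
* `pi1Map_ρE_surjective_of_isolated` (`…_of_isIsolatedEdge`) — **at an isolated edge `e′` of ANY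
  semi-graph of anabelioids `ℋ`, `π₁(ρ_{e′}) : Aut F → Aut (ρ_{e′} ⋙ F)` is surjective** (extend
  `T ∈ ℋ_{e′}` by terminal objects: no gluing constraint involves `e′`; limits in `B(ℋ)` are
  componentwise, `hasLimitsOfShape_bObj`);
* `Hom.ι_comp_pi1Map_ρE_eq`, `Hom.comap_pi1Map_ρE_stabilizer`, `Hom.ker_pi1Map_ρE_le_stabilizer`,
  `Hom.stabilizer_le_of_surjective` — the edge twins of the vertex bookkeeping of
  `VertexAlignedStabilizers` (square of basepoints, stabilisers through `π₁(ρ_f)`, the kernel of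
  `Π_f → Π_{𝒦,f}` fixes the points of `F(Q)` for `Q ↪ A_f`), assembled: `Stab(a₀) ≤ Stab(q₀)`;
* `Hom.sectionMapE_mono_of_isolated` — **`Mono σ_{e′}` at an isolated `e′`**, and the wrapper
  `Hom.sectionMapE_mono_of_isIsolatedEdge` from `SemiGraph.IsIsolatedEdge` (verticial cardinality `0`).

No `def`, no new `Prop`; nothing here takes a side on [IUTchIII] Cor. 3.12.
-/

namespace Literature.AnabelianGeometry.SemiGraphs

open CategoryTheory CategoryTheory.Limits CategoryTheory.PreGaloisCategory
open Literature.AnabelianGeometry.Anabelioids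

universe v₁ u₁ u

/-! ### Part A. Group theory of the square with a surjective leg -/

section GroupTheory

variable {Γw ΓH Γu ΓK : Type*} [Group Γw] [Group ΓH] [Group Γu] [Group ΓK]

/-- **A square with a surjective leg pins the preimage.**  For homomorphisms `ι_w : Π_{e′} → Π_f`,
`j : Π_f → Π_{𝒦,f}`, `k : Π_{e′} → Π_{ℋ,e′}`, `ι : Π_{ℋ,e′} → Π_{𝒦,f}` with `j ∘ ι_w = ι ∘ k`, if `k` is
SURJECTIVE and `ker j ≤ ι_w(Π_{e′})`, then `j⁻¹(ι(Π_{ℋ,e′})) = ι_w(Π_{e′})`.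
[cite: MochizukiSemiAnbd2006, Rem. 2.2.1 p.24] -/
theorem comap_range_eq_range_of_surjective (ι : ΓH →* ΓK) (j : Γu →* ΓK) (ιw : Γw →* Γu)
    (k : Γw →* ΓH) (hsq : j.comp ιw = ι.comp k) (hk : Function.Surjective k)
    (hker : j.ker ≤ ιw.range) : ι.range.comap j = ιw.range := by
  apply le_antisymm
  · intro g hg
    obtain ⟨t, ht⟩ := hg
    obtain ⟨s, rfl⟩ := hk t
    have h1 : j g = j (ιw s) := by
      rw [← ht, ← MonoidHom.comp_apply, ← hsq, MonoidHom.comp_apply]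
    have h2 : (ιw s)⁻¹ * g ∈ j.ker := by
      rw [MonoidHom.mem_ker, map_mul, map_inv, h1, inv_mul_cancel]
    have h3 : g = ιw s * ((ιw s)⁻¹ * g) := by group
    rw [h3]
    exact mul_mem ⟨s, rfl⟩ (hker h2)
  · rintro _ ⟨h, rfl⟩
    change j (ιw h) ∈ ι.range
    rw [← MonoidHom.comp_apply, hsq]
    exact ⟨k h, rfl⟩

end GroupTheory

/-! ### Part B. Surjectivity of whiskering along a functor with objectwise sections -/

section Sections

universe w u₂ v₂ u₃ v₃

variable {D : Type u₂} [Category.{v₂} D] {D' : Type u₃} [Category.{v₃} D']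

/-- **Whiskering along a functor with objectwise sections is surjective on `Aut` of basepoints.**
Let `G : D ⥤ D′`; suppose every object `T` of `D′` has a chosen preimage `j T` with `ε_T : G (j T) ≅ T`,
every morphism `g : T ⟶ T′` a lift `j T ⟶ j T′` mapping to `ε_T ≫ g ≫ ε_{T′}⁻¹`, and every object `X`
of `D` a morphism `u_X : X ⟶ j (G X)` with `G(u_X) ≫ ε = 𝟙`.  Then for every `F : D′ ⥤ FintypeCat`,
`π₁(G) : Aut F → Aut (G ⋙ F)` is surjective: `τ ↦ (T ↦ F(ε⁻¹) ≫ τ_{j T} ≫ F(ε))`.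
[cite: MochizukiGeoAn2004, Def. 1.1.2(ii) p.10] -/
theorem pi1Map_surjective_of_section (G : D ⥤ D') (F : D' ⥤ FintypeCat.{w}) (j : D' → D)
    (ε : ∀ T : D', G.obj (j T) ≅ T)
    (jmap : ∀ {T T' : D'}, (T ⟶ T') → (j T ⟶ j T'))
    (hjmap : ∀ {T T' : D'} (g : T ⟶ T'), G.map (jmap g) = (ε T).hom ≫ g ≫ (ε T').inv)
    (u : ∀ X : D, X ⟶ j (G.obj X)) (hu : ∀ X : D, G.map (u X) ≫ (ε (G.obj X)).hom = 𝟙 _) :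
    Function.Surjective (pi1Map G F) := by
  intro τ
  -- `F(ε) ∘ F(ε⁻¹) = id` on elements
  have hε : ∀ (T : D') (y : F.obj T), F.map (ε T).hom (F.map (ε T).inv y) = y := fun T y =>
    ConcreteCategory.congr_hom (F.mapIso (ε T)).inv_hom_id y
  -- naturality of `τ` along the lifts `jmap g`, on elements
  have hτj : ∀ {T T' : D'} (g : T ⟶ T') (y : F.obj (G.obj (j T))),
      τ.hom.app (j T') (F.map (ε T').inv (F.map g (F.map (ε T).hom y))) =
        F.map (ε T').inv (F.map g (F.map (ε T).hom (τ.hom.app (j T) y))) := by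
    intro T T' g y
    have h := FunctorToFintypeCat.naturality (G ⋙ F) (G ⋙ F) τ.hom (jmap g) y
    have hG : ∀ z : F.obj (G.obj (j T)),
        (G ⋙ F).map (jmap g) z = F.map (ε T').inv (F.map g (F.map (ε T).hom z)) := fun z => by
      change F.map (G.map (jmap g)) z = _
      rw [hjmap, F.map_comp, F.map_comp, FintypeCat.comp_apply, FintypeCat.comp_apply]
    rw [hG, hG] at h
    exact h
  let σ : F ≅ F := NatIso.ofComponents
    (fun T => F.mapIso (ε T).symm ≪≫ τ.app (j T) ≪≫ F.mapIso (ε T)) (by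
      intro T T' g
      ext x
      change F.map (ε T').hom (τ.hom.app (j T') (F.map (ε T').inv (F.map g x))) =
        F.map g (F.map (ε T).hom (τ.hom.app (j T) (F.map (ε T).inv x)))
      have h := hτj g (F.map (ε T).inv x)
      rw [hε] at h
      rw [h, hε])
  refine ⟨σ, Iso.ext (NatTrans.ext (funext fun X => ?_))⟩
  ext x
  rw [pi1Map_hom_app]
  change F.map (ε (G.obj X)).hom (τ.hom.app (j (G.obj X)) (F.map (ε (G.obj X)).inv x)) =
    τ.hom.app X x
  have hGu : G.map (u X) = (ε (G.obj X)).inv := by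
    rw [← Iso.comp_hom_eq_id (ε (G.obj X))]
    exact hu X
  have h := FunctorToFintypeCat.naturality (G ⋙ F) (G ⋙ F) τ.hom (u X) x
  have hG : ∀ z : F.obj (G.obj X), (G ⋙ F).map (u X) z = F.map (ε (G.obj X)).inv z := fun z => by
    change F.map (G.map (u X)) z = _
    rw [hGu]
  rw [hG, hG] at h
  rw [h, hε]

end Sections

/-! ### Part C. Isolated edges: `π₁(ρ_{e′})` is surjective; edge bookkeeping -/

namespace SemiGraphOfAnabelioids

universe w

/-- A branch of an isolated edge abuts to no vertex: `edgeOf b = e′ ⇒ abuts b = none`, from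
`SemiGraph.IsIsolatedEdge e′` (verticial cardinality `0`). [cite: MochizukiSemiAnbd2006, §1 p.12] -/
theorem _root_.Literature.AnabelianGeometry.SemiGraphs.SemiGraph.IsIsolatedEdge.abuts_eq_none
    {G : SemiGraph.{u}} {e' : G.Edge} (he' : G.IsIsolatedEdge e') (b : G.Branch)
    (hb : G.edgeOf b = e') : G.abuts b = none := by
  obtain ⟨b₁, b₂, -, -, -, hall⟩ := G.two_branches e'
  have hfin : (G.verticialPortion e').Finite :=
    (Set.toFinite ({b₁, b₂} : Set G.Branch)).subset fun x hx => by
      rcases hall x hx.1 with rfl | rfl <;> simp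
  have h0 : G.verticialPortion e' = ∅ := (Set.ncard_eq_zero hfin).mp he'
  by_contra hne
  have : b ∈ G.verticialPortion e' := ⟨hb, Option.ne_none_iff_isSome.mp hne⟩
  rw [h0] at this
  exact this

/-- A branch abutting to a vertex is not a branch of an isolated edge.
[cite: MochizukiSemiAnbd2006, §1 p.12] -/
theorem edgeOf_ne_of_isolated (ℋ : SemiGraphOfAnabelioids.{v₁, u₁, u}) {e' : ℋ.graph.Edge}
    (he' : ∀ b, ℋ.graph.edgeOf b = e' → ℋ.graph.abuts b = none)
    (b : ℋ.graph.Branch) (v : ℋ.graph.Vertex) (h : ℋ.graph.abuts b = some v) :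
    ℋ.graph.edgeOf b ≠ e' := fun hb => by
  have := he' b hb
  rw [h] at this
  exact Option.some_ne_none v this

/-- **At an isolated edge `e′`, `π₁(ρ_{e′}) : Aut F → Aut (ρ_{e′} ⋙ F)` is surjective**, for ANY
semi-graph of anabelioids `ℋ` and any `F : ℋ_{e′} ⥤ FintypeCat`: an object `T` of `ℋ_{e′}` extends to
the object of `B(ℋ)` which is `T` at `e′` and terminal at every other constituent (no gluing
isomorphism involves `e′`), every object `X` of `B(ℋ)` maps to the extension of `X_{e′}` (terminal maps
elsewhere), and `pi1Map_surjective_of_section` applies.  (At a NON-isolated edge this fails in general: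
the image is the decomposition group of the edge.) [cite: MochizukiSemiAnbd2006, Rem. 2.2.1 p.24] -/
theorem pi1Map_ρE_surjective_of_isolated (ℋ : SemiGraphOfAnabelioids.{v₁, u₁, u})
    (e' : ℋ.graph.Edge) (he' : ∀ b, ℋ.graph.edgeOf b = e' → ℋ.graph.abuts b = none)
    (F : ℋ.E e' ⥤ FintypeCat.{w}) : Function.Surjective (pi1Map (ℋ.ρE e') F) := by
  classical
  obtain ⟨hT, hρ, hρE⟩ := ℋ.hasLimitsOfShape_bObj (J := Discrete PEmpty.{1})
  haveI : HasTerminal ℋ.BObj := hT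
  let Ω : ℋ.BObj := ⊤_ ℋ.BObj
  -- the constituents of `Ω` are terminal
  have hΩS : ∀ v, IsTerminal (Ω.S v) := fun v => by
    haveI := hρ v
    exact terminalIsTerminal.isTerminalObj (ℋ.ρ v) Ω
  have hΩT : ∀ f, IsTerminal (Ω.T f) := fun f => by
    haveI := hρE f
    exact terminalIsTerminal.isTerminalObj (ℋ.ρE f) Ω
  have hne := ℋ.edgeOf_ne_of_isolated he'
  -- the extension of `T ∈ ℋ_{e′}` by terminal objects
  let jObj : ℋ.E e' → ℋ.BObj := fun T =>
    { S := Ω.S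
      T := Function.update Ω.T e' T
      ψ := fun b v h => Ω.ψ b v h ≪≫ eqToIso (Function.update_of_ne (hne b v h) T Ω.T).symm }
  have hjT : ∀ (T : ℋ.E e') (b : ℋ.graph.Branch) (v : ℋ.graph.Vertex)
      (h : ℋ.graph.abuts b = some v), IsTerminal ((jObj T).T (ℋ.graph.edgeOf b)) := fun T b v h =>
    (hΩT (ℋ.graph.edgeOf b)).ofIso (eqToIso (Function.update_of_ne (hne b v h) T Ω.T).symm)
  have hε : ∀ T : ℋ.E e', (jObj T).T e' = T := fun T => Function.update_self e' T Ω.T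
  -- morphisms into an extension are free at `e′`
  let mk : ∀ (X : ℋ.BObj) (T : ℋ.E e'), (X.T e' ⟶ T) → (X ⟶ jObj T) := fun X T g =>
    { fS := fun v => (hΩS v).from (X.S v)
      fT := fun f => if hf : f = e' then (by subst hf; exact g ≫ eqToHom (hε T).symm)
        else (hΩT f).from (X.T f) ≫ eqToHom (Function.update_of_ne hf T Ω.T).symm
      comm := fun b v h => (hjT T b v h).hom_ext _ _ }
  refine pi1Map_surjective_of_section (ℋ.ρE e') F jObj (fun T => eqToIso (hε T))
    (fun {T T'} g => mk (jObj T) T' (eqToHom (hε T) ≫ g)) (fun {T T'} g => ?_)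
    (fun X => mk X (X.T e') (𝟙 _)) (fun X => ?_)
  · -- the lift of `g` is `ε ≫ g ≫ ε′⁻¹` at `e′`
    change (mk (jObj T) T' (eqToHom (hε T) ≫ g)).fT e' =
      eqToHom (hε T) ≫ g ≫ eqToHom (hε T').symm
    simp only [mk, dif_pos, Category.assoc]
  · -- the map `X ⟶ j (X_{e′})` is the identity at `e′`, up to `ε`
    change (mk X (X.T e') (𝟙 _)).fT e' ≫ eqToHom (hε (X.T e')) = 𝟙 (X.T e')
    simp only [mk, dif_pos, Category.id_comp, eqToHom_trans, eqToHom_refl]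

/-- **… in particular at an edge which `SemiGraph.IsIsolatedEdge`.** [cite: MochizukiSemiAnbd2006, §1 p.12] -/
theorem pi1Map_ρE_surjective_of_isIsolatedEdge (ℋ : SemiGraphOfAnabelioids.{v₁, u₁, u})
    (e' : ℋ.graph.Edge) (he' : ℋ.graph.IsIsolatedEdge e') (F : ℋ.E e' ⥤ FintypeCat.{w}) :
    Function.Surjective (pi1Map (ℋ.ρE e') F) :=
  ℋ.pi1Map_ρE_surjective_of_isolated e' he'.abuts_eq_none F

namespace Hom

variable {ℋ 𝒦 : SemiGraphOfAnabelioids.{v₁, u₁, u}}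

/-- The square `Π_{e′} → Π_{ℋ,e′} → Π_{𝒦,f}` = `Π_{e′} → Π_f → Π_{𝒦,f}` at the level of automorphism
groups of basepoints, for ANY morphism `ψ`, edge `e′ ↦ f` (presented as `p : ψ e′ = f`) and frame
`eE : ψ_{e′}^* ⋙ F_{e′} ≅ F`: the left leg is `Aut(β) ∘ π₁(ψ^*)` for the evident
`β = F_{e′}(reindex) ≪≫ ρ_f(eE)`, the right leg `π₁(ρ_f)` after `Aut(eE) ∘ π₁(ψ_{e′}^*)`.
[cite: MochizukiSemiAnbd2006, Rem. 2.2.1 p.24] -/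
theorem ι_comp_pi1Map_ρE_eq (ψ : Hom ℋ 𝒦) (e' : ℋ.graph.Edge) (f : 𝒦.graph.Edge)
    (p : ψ.base.edgeMap e' = f) (Fe' : ℋ.E e' ⥤ FintypeCat.{v₁}) (F : 𝒦.E f ⥤ FintypeCat.{v₁})
    (eE : (ψ.φE e' f p).pullback ⋙ Fe' ≅ F) :
    ((Aut.autMulEquivOfIso
        (Functor.isoWhiskerRight (ψ.reindexIso e' (ψ.base.edgeMap e') f rfl p) Fe' ≪≫
          Functor.isoWhiskerLeft (𝒦.ρE f) eE)).toMonoidHom.comp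
        (pi1Map ψ.pullbackFunctor (ℋ.ρE e' ⋙ Fe'))).comp (pi1Map (ℋ.ρE e') Fe') =
      (pi1Map (𝒦.ρE f) F).comp
        ((Aut.autMulEquivOfIso eE).toMonoidHom.comp (pi1Map (ψ.φE e' f p).pullback Fe')) := by
  subst p
  refine MonoidHom.ext fun s => Iso.ext (NatTrans.ext (funext fun X => ?_))
  change (Functor.isoWhiskerRight (ψ.reindexIso e' (ψ.base.edgeMap e') _ rfl rfl) Fe' ≪≫
        Functor.isoWhiskerLeft (𝒦.ρE _) eE).inv.app X ≫
      s.hom.app ((ψ.pullbackFunctor.obj X).T e') ≫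
      (Functor.isoWhiskerRight (ψ.reindexIso e' (ψ.base.edgeMap e') _ rfl rfl) Fe' ≪≫
        Functor.isoWhiskerLeft (𝒦.ρE _) eE).hom.app X =
    eE.inv.app (X.T (ψ.base.edgeMap e')) ≫
      s.hom.app ((ψ.φE e' (ψ.base.edgeMap e') rfl).pullback.obj (X.T (ψ.base.edgeMap e'))) ≫
      eE.hom.app (X.T (ψ.base.edgeMap e'))
  simp only [reindexIso_rfl_eq, Iso.trans_hom, Iso.trans_inv, NatTrans.comp_app,
    Functor.isoWhiskerRight_hom, Functor.isoWhiskerRight_inv, Functor.isoWhiskerLeft_hom,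
    Functor.isoWhiskerLeft_inv, Functor.whiskerRight_app, Functor.whiskerLeft_app, Iso.refl_hom,
    Iso.refl_inv, NatTrans.id_app, CategoryTheory.Functor.map_id, Category.assoc]
  rfl

/-- Through `π₁(ρ_f) : Π_f = Aut F → Aut (ρ_f ⋙ F)`, the stabiliser of a point of the fibre
`(ρ_f ⋙ F)(X) = F(X_f)` pulls back to its stabiliser in `Π_f` (the action of `Π_f` on `F(X_f)` IS the
pulled-back one; no injectivity of `Π_f → Π_𝒦` is involved). [cite: MochizukiSemiAnbd2006, Rem. 2.2.1 p.24] -/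
theorem comap_pi1Map_ρE_stabilizer (f : 𝒦.graph.Edge) (F : 𝒦.E f ⥤ FintypeCat.{v₁}) {X : 𝒦.BObj}
    (a : (𝒦.ρE f ⋙ F).obj X) :
    (MulAction.stabilizer (Aut (𝒦.ρE f ⋙ F)) a).comap (pi1Map (𝒦.ρE f) F) =
      MulAction.stabilizer (Aut F) (show F.obj (X.T f) from a) := by
  ext g
  rfl

/-- The kernel of `Π_f → Aut (ρ_f ⋙ F)` fixes every point of `F(Q)` for `Q ↪ X_f` a subobject of a
RESTRICTED object (it acts trivially on `F(X_f) ⊇ F(Q)`). [cite: MochizukiSemiAnbd2006, Rem. 2.2.1 p.24] -/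
theorem ker_pi1Map_ρE_le_stabilizer (f : 𝒦.graph.Edge) (F : 𝒦.E f ⥤ FintypeCat.{v₁}) [FiberFunctor F]
    {X : 𝒦.BObj} {Q : 𝒦.E f} (m : Q ⟶ X.T f) [Mono m] (q : F.obj Q) :
    (pi1Map (𝒦.ρE f) F).ker ≤ MulAction.stabilizer (Aut F) q := by
  intro g hg
  rw [MulAction.mem_stabilizer_iff]
  haveI : Mono (F.map m) := inferInstance
  have hinj : Function.Injective (F.map m) :=
    ConcreteCategory.injective_of_mono_of_preservesPullback (F.map m)
  apply hinj
  rw [map_smul_aut]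
  have h1 : (pi1Map (𝒦.ρE f) F g) • (show (𝒦.ρE f ⋙ F).obj X from F.map m q) = F.map m q := by
    rw [MonoidHom.mem_ker.mp hg, one_smul]
  exact h1

/-- **Surjective square ⇒ the global point's stabiliser does not exceed the local one.**  For
homomorphisms `ι : Π_{ℋ,e′} → Π_{𝒦,f} = Aut (ρ_f ⋙ F)`, `ι_{e′} : Π_{e′} → Π_f = Aut F`, `k : Π_{e′} → Π_{ℋ,e′}`
with `π₁(ρ_f) ∘ ι_{e′} = ι ∘ k` and `k` SURJECTIVE, a point `a₀ ∈ F(X_f)` with `ι(Π_{ℋ,e′}) = Stab(a₀)` and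
a point `q₀ ∈ F(Q)`, `Q ↪ X_f`, with `ι_{e′}(Π_{e′}) = Stab(q₀)`: `Stab_{Π_f}(a₀) ≤ Stab_{Π_f}(q₀)`
(`comap_range_eq_range_of_surjective`, the kernel of `Π_f → Aut (ρ_f ⋙ F)` fixing `q₀`).
[cite: MochizukiSemiAnbd2006, Rem. 2.2.1 p.24] -/
theorem stabilizer_le_of_surjective (f : 𝒦.graph.Edge) (F : 𝒦.E f ⥤ FintypeCat.{v₁}) [FiberFunctor F]
    {ΓH Γe : Type*} [Group ΓH] [Group Γe] (ι : ΓH →* Aut (𝒦.ρE f ⋙ F)) (ιe : Γe →* Aut F)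
    (k : Γe →* ΓH) (hsq : (pi1Map (𝒦.ρE f) F).comp ιe = ι.comp k) (hk : Function.Surjective k)
    {X : 𝒦.BObj} (a₀ : (𝒦.ρE f ⋙ F).obj X)
    (ha : ι.range = MulAction.stabilizer (Aut (𝒦.ρE f ⋙ F)) a₀)
    {Q : 𝒦.E f} (m : Q ⟶ X.T f) [Mono m] (q₀ : F.obj Q)
    (hq : ιe.range = MulAction.stabilizer (Aut F) q₀) :
    MulAction.stabilizer (Aut F) (show F.obj (X.T f) from a₀) ≤ MulAction.stabilizer (Aut F) q₀ := by
  rw [← comap_pi1Map_ρE_stabilizer, ← ha, ← hq]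
  refine (comap_range_eq_range_of_surjective ι _ ιe k hsq hk ?_).le
  rw [hq]
  exact ker_pi1Map_ρE_le_stabilizer f F m q₀

set_option backward.isDefEq.respectTransparency false in
/-- **(E-σ-ISO) The edge section map at an ISOLATED edge is a monomorphism — no alignment needed.**
Let `ψ : ℋ → 𝒦` be ANY morphism, `A ∈ B(𝒦)` with a global witness `αψ : B(𝒦)_{/A} ⥲ B(ℋ)`,
`e_ψ : ψ^* ≅ (A × −) ⋙ αψ`; `e′` an edge of `ℋ` NO branch of which abuts to a vertex, over `f` (`p : ψ e′ = f`);
a local edge witness `α_{e′} : (𝒦_f)_{/Q} ⥲ ℋ_{e′}`, `e_{e′}`, on a CONNECTED `Q ↪ A_f`.  Then the section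
map `σ_{e′} : Q ⟶ A_f` of `K_{e′} = αψ ⋙ ρ_{e′} ⋙ α_{e′}⁻¹` with its evident identification
(`EdgeSectionBasePoint`) is a monomorphism, for any terminality witness `hT` of `K_{e′}(𝟙_A)`:
`Stab_{Π_f}(σ q₀) = Stab(edge global point)` (`map_sectionMapE_basePoint_std`) is the preimage of
`ι(Π_{ℋ,e′})` (`range_pi1Map_eq_stabilizer′` at the edge basepoint `ρ_{e′} ⋙ F_{e′}` of `B(ℋ)`), which is
`ι_{e′}(Π_{e′}) = Stab(q₀)` because `Π_{e′} → Π_{ℋ,e′}` is ONTO at an isolated edge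
(`pi1Map_ρE_surjective_of_isolated`) and `ker(Π_f → Π_{𝒦,f})` fixes `q₀` (`Q ↪ A_f`).
[cite: MochizukiSemiAnbd2006, Rem. 2.2.1 p.24] -/
theorem sectionMapE_mono_of_isolated (ψ : Hom ℋ 𝒦) (A : 𝒦.BObj) [HasBinaryProducts 𝒦.BObj]
    (αψ : Over A ⥤ ℋ.BObj) [αψ.IsEquivalence] (eψ : ψ.pullbackFunctor ≅ Over.star A ⋙ αψ)
    (e' : ℋ.graph.Edge) (he' : ∀ b, ℋ.graph.edgeOf b = e' → ℋ.graph.abuts b = none)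
    (f : 𝒦.graph.Edge) (p : ψ.base.edgeMap e' = f)
    {Q : 𝒦.E f} [PreGaloisCategory.IsConnected Q] (mQ : Q ⟶ A.T f) [Mono mQ]
    (αE : Over Q ⥤ ℋ.E e') [αE.IsEquivalence]
    (eEloc : (ψ.φE e' f p).pullback ≅ Over.star Q ⋙ αE)
    (hT : IsTerminal ((αψ ⋙ ℋ.ρE e' ⋙ αE.inv).obj (Over.mk (𝟙 A)))) :
    Mono (OverStar.sectionMap (Over.forgetAdjStar A) (Over.forgetAdjStar Q)
      (αψ ⋙ ℋ.ρE e' ⋙ αE.inv) (𝒦.ρE f)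
      (Functor.isoWhiskerRight eψ.symm (ℋ.ρE e' ⋙ αE.inv) ≪≫
        Functor.isoWhiskerRight (ψ.reindexIso e' (ψ.base.edgeMap e') f rfl p) αE.inv ≪≫
        Functor.isoWhiskerLeft (𝒦.ρE f) (Functor.isoWhiskerRight eEloc αE.inv) ≪≫
        Functor.isoWhiskerLeft (𝒦.ρE f ⋙ Over.star Q) αE.asEquivalence.unitIso.symm :
          Over.star A ⋙ (αψ ⋙ ℋ.ρE e' ⋙ αE.inv) ≅ 𝒦.ρE f ⋙ Over.star Q) hT) := by
  -- basepoints: `F_{e′}` of `ℋ_{e′}` and the induced `F := ψ_{e′}^* ⋙ F_{e′}` of `𝒦_f`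
  obtain ⟨Fe', ⟨hFe'⟩⟩ := GaloisCategory.hasFiberFunctor (C := ℋ.E e')
  let F : 𝒦.E f ⥤ FintypeCat.{v₁} := (ψ.φE e' f p).pullback ⋙ Fe'
  haveI : FiberFunctor F := fiberFunctor_comp_of_exact _ Fe'
  obtain ⟨eTE⟩ := nonempty_equiv_fiber_terminal_punit Fe'
  -- one-point fibre of the global terminal object `αψ 𝟙_A` at `e′`
  obtain ⟨-, -, hρE⟩ := ℋ.hasLimitsOfShape_bObj (J := Discrete PEmpty.{1})
  haveI := hρE e'
  have hTA : IsTerminal (αψ.obj (Over.mk (𝟙 A))) := Over.mkIdTerminal.isTerminalObj αψ _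
  let iE : (ℋ.ρE e').obj (αψ.obj (Over.mk (𝟙 A))) ≅ ⊤_ (ℋ.E e') :=
    (hTA.isTerminalObj (ℋ.ρE e') _).uniqueUpToIso terminalIsTerminal
  haveI hsE : Subsingleton (Fe'.obj ((αψ.obj (Over.mk (𝟙 A))).T e')) :=
    ((FintypeCat.equivEquivIso.symm (Fe'.mapIso iE)).trans eTE).subsingleton
  haveI : Subsingleton ((ℋ.ρE e' ⋙ Fe').obj (αψ.obj (Over.mk (𝟙 A)))) := hsE
  let tE : (ℋ.ρE e' ⋙ Fe').obj (αψ.obj (Over.mk (𝟙 A))) :=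
    (FintypeCat.equivEquivIso.symm (Fe'.mapIso iE)).symm (eTE.symm PUnit.unit)
  -- one-point fibre of the local terminal object `α_{e′} 𝟙_Q`
  let iQ : αE.obj (Over.mk (𝟙 Q)) ≅ ⊤_ (ℋ.E e') :=
    (Over.mkIdTerminal.isTerminalObj αE _).uniqueUpToIso terminalIsTerminal
  haveI : Subsingleton (Fe'.obj (αE.obj (Over.mk (𝟙 Q)))) :=
    ((FintypeCat.equivEquivIso.symm (Fe'.mapIso iQ)).trans eTE).subsingleton
  let t'E : Fe'.obj (αE.obj (Over.mk (𝟙 Q))) :=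
    (FintypeCat.equivEquivIso.symm (Fe'.mapIso iQ)).symm (eTE.symm PUnit.unit)
  -- the edge basepoint `ρ_{e′} ⋙ F_{e′}` of `B(ℋ)` preserves pull-backs and monomorphisms
  obtain ⟨-, -, hρE₂⟩ := ℋ.hasLimitsOfShape_bObj (J := WalkingCospan)
  haveI := hρE₂ e'
  haveI : PreservesLimitsOfShape WalkingCospan (ℋ.ρE e' ⋙ Fe') := inferInstance
  haveI : (ℋ.ρE e' ⋙ Fe').PreservesMonomorphisms := inferInstance
  -- (D1) twice: global at the edge basepoint `ρ_{e′} ⋙ F_{e′}` of `B(ℋ)`, local at `e′`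
  have ha := range_pi1Map_eq_stabilizer' αψ eψ (ℋ.ρE e' ⋙ Fe')
    (Functor.isoWhiskerRight (ψ.reindexIso e' (ψ.base.edgeMap e') f rfl p) Fe' ≪≫
      Functor.isoWhiskerLeft (𝒦.ρE f) (Iso.refl F)) tE
  have hq := range_pi1Map_eq_stabilizer' αE eEloc Fe' (Iso.refl F) t'E
  -- the section sends the local edge base point `q₀` to the edge global point
  have key := map_sectionMapE_basePoint_std ψ A αψ eψ e' f p Q αE eEloc hT Fe' F (Iso.refl F) tE t'E
  refine mono_of_stabilizer_le F _ ((Iso.refl F).hom.app Q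
    (Fe'.map (αE.map ((Over.forgetAdjStar Q).unit.app (Over.mk (𝟙 Q))) ≫ eEloc.inv.app Q) t'E)) ?_
  rw [key]
  exact stabilizer_le_of_surjective f F _ _ (pi1Map (ℋ.ρE e') Fe')
    (ψ.ι_comp_pi1Map_ρE_eq e' f p Fe' F (Iso.refl F)).symm
    (ℋ.pi1Map_ρE_surjective_of_isolated e' he' Fe') _ ha mQ _ hq

/-- **(E-σ-ISO) from `SemiGraph.IsIsolatedEdge`.** [cite: MochizukiSemiAnbd2006, Rem. 2.2.1 p.24] -/
theorem sectionMapE_mono_of_isIsolatedEdge (ψ : Hom ℋ 𝒦) (A : 𝒦.BObj) [HasBinaryProducts 𝒦.BObj]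
    (αψ : Over A ⥤ ℋ.BObj) [αψ.IsEquivalence] (eψ : ψ.pullbackFunctor ≅ Over.star A ⋙ αψ)
    (e' : ℋ.graph.Edge) (he' : ℋ.graph.IsIsolatedEdge e')
    (f : 𝒦.graph.Edge) (p : ψ.base.edgeMap e' = f)
    {Q : 𝒦.E f} [PreGaloisCategory.IsConnected Q] (mQ : Q ⟶ A.T f) [Mono mQ]
    (αE : Over Q ⥤ ℋ.E e') [αE.IsEquivalence]
    (eEloc : (ψ.φE e' f p).pullback ≅ Over.star Q ⋙ αE)
    (hT : IsTerminal ((αψ ⋙ ℋ.ρE e' ⋙ αE.inv).obj (Over.mk (𝟙 A)))) :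
    Mono (OverStar.sectionMap (Over.forgetAdjStar A) (Over.forgetAdjStar Q)
      (αψ ⋙ ℋ.ρE e' ⋙ αE.inv) (𝒦.ρE f)
      (Functor.isoWhiskerRight eψ.symm (ℋ.ρE e' ⋙ αE.inv) ≪≫
        Functor.isoWhiskerRight (ψ.reindexIso e' (ψ.base.edgeMap e') f rfl p) αE.inv ≪≫
        Functor.isoWhiskerLeft (𝒦.ρE f) (Functor.isoWhiskerRight eEloc αE.inv) ≪≫
        Functor.isoWhiskerLeft (𝒦.ρE f ⋙ Over.star Q) αE.asEquivalence.unitIso.symm :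
          Over.star A ⋙ (αψ ⋙ ℋ.ρE e' ⋙ αE.inv) ≅ 𝒦.ρE f ⋙ Over.star Q) hT) :=
  ψ.sectionMapE_mono_of_isolated A αψ eψ e' he'.abuts_eq_none f p mQ αE eEloc hT

end Hom

end SemiGraphOfAnabelioids

end Literature.AnabelianGeometry.SemiGraphs
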